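import Mathlib
import Summits.NavierStokesRegularity.FluidComputer.TransportGalerkinResidencePrep
import HarnessLib

/-!
# Galerkin limit of the transport model, IX: RESIDENCE of the Galerkin levels from an `H²` bound (instab g19, cell `ns-blowup`, 2026-08-27)

HONEST FRAMING (human ruling D-0035): nothing here is a claim about Navier–Stokes blow-up.
WHAT THIS IS NOT: not NS evidence — Gronwall bookkeeping on the scaled phase space
`E = lp (ℤ^d → V) 2` of the R-β chain; the Galerkin trajectory and its `H²` bound are hypotheses,
no flow or certificate is constructed.

PURPOSE. `HOME/instab/BETA2-SPEC.md` §6 priced RESIDENCE (β3) — «the Galerkin levels from the seed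
stay in the polynomial box `W` on the window» — as computer-assisted `C¹`-integration (engine class
M–L, not owned). THIS FILE PROVES IT IS CLASSICAL FOR `ν > 0`: a level-`N` Galerkin trajectory
`y` of `y' = P_N F(y)` (`F = nsField ν Uv π P`) which is `P_N`-fixed, satisfies the linear box
clauses, and obeys the `E`-norm (`= H²`) bound `‖y t‖ ≤ r` on `[0, T]` — the bound the KEEP/KILL
bootstrap ITSELF provides (`≤ (3/2)εe^{λt}`, resp. `≤ 2ε`) — has

* (§3, `energy_three_le`) `‖Λ⁻² ⇑(y t)‖₃² ≤ gronwallBound S₃(0) α₃ β₃ t` with LEVEL-INDEPENDENT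
  `α₃ = 2ν(2π)² + 2H(3)`, `β₃ = 27 c⁴ r⁶ / (256 (2ν(2π)²)³)`, `c = 2K₃σ₂` — the self-advection
  `2K₃ A₁(û) S₃ ≤ 2K₃σ₂ S₃^{3/2}` (Cauchy–Schwarz `A₁ ≤ σ₂‖û‖₃`, `σ₂² = ∑⟨l⟩⁻⁴`) is ABSORBED by the
  exact dissipation through `S₃² ≤ S₂ S₄ ≤ r² S₄` and `cY³ ≤ εY⁴ + 27c⁴/(256ε³)` (§1);
* (§4, `energy_le_of_energy_three_le`) for every `σ ≥ 1`, `S_σ(t) ≤ S_σ(0) e^{α t}` with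
  `α = 2ν(2π)² + 2H(σ) + 2K_σ σ₂ √R₃` once `S₃ ≤ R₃` on the window (linear Gronwall);
* (§5, `norm_apply_le_of_energy`) hence coordinate bounds `‖(y t) k‖ ≤ √R ⟨k⟩^{−s}` from
  `‖⇑(y t)‖_s² ≤ R` — i.e. membership in ONE polynomial box for all levels sharing `r` and the
  initial energies (the seed `ε P_N v` has `S_σ(0) ≤ ε² ‖v‖²_{σ}` for every `N`).

So between the certificates and the KEEP/KILL words for the model NO computer-assisted integration
stands: residence = (global existence of the finite-dimensional Galerkin ODE) + (the bootstrap's own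
`H²` bound) + THIS FILE. The size of the box never enters the KEEP floor (only the (C1)/(C2)
constants, of any sign), so the Gronwall constants may be astronomically large.

References: classical `H^m` energy method / parabolic regularisation for Navier–Stokes (Majda–Bertozzi
2002 §3.2; Constantin–Foias 1988 Ch. 10; Robinson–Rodrigo–Sadowski 2016 Ch. 6–7) [folklore shape].
-/

noncomputable section

open scoped ENNReal NNReal ComplexConjugate InnerProductSpace
open Set Filter Topology

namespace Summit.NavierStokesRegularity.FluidComputer.TransportGalerkinResidence

open RCLike
open Literature.Analysis.FunctionSpaces Literature.Analysis.FunctionSpaces.Lattice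
open Literature.Analysis.FunctionSpaces.Torus
open Literature.Analysis.ODE
open Summit.NavierStokesRegularity.FluidComputer.GalerkinLatticePhaseSpace
open Summit.NavierStokesRegularity.FluidComputer.TransportGalerkin
open Summit.NavierStokesRegularity.FluidComputer.TransportGalerkinRapid
open Summit.NavierStokesRegularity.FluidComputer.TransportGalerkinBox
open Summit.NavierStokesRegularity.FluidComputer.TransportGalerkinWeights
open Summit.NavierStokesRegularity.FluidComputer.TransportGalerkinEnergyLevel
open Summit.NavierStokesRegularity.FluidComputer.TransportGalerkinResidencePrep

variable {d : Type*} [Fintype d] [DecidableEq d]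
variable {V : Type*} [NormedAddCommGroup V] [InnerProductSpace ℂ V] [CompleteSpace V]

/-! ## §3 Order three: the self-advection is absorbed by dissipation -/

section OrderThree

variable {ν : ℝ} {Uv : (d → ℤ) → V} {π : d → (V →L[ℂ] ℂ)} {P : (d → ℤ) → (V →L[ℂ] V)}
  {ρ : (d → ℤ) → ℝ}

/-- **Order three (`energy_three_le`).** Host: `ν > 0`, `Uv` rapidly decreasing, real and
divergence-free through `π` (‖π_j‖ ≤ 1), `P` modewise self-adjoint contractions, and the lattice
constant `σ₂² = ∑⟨l⟩⁻⁴ < ∞` (true for `card d ≤ 3`). Trajectory: `y : ℝ → E` continuous on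
`[0, T]`, right-differentiable on `[0, T)` with `y' = P_N F(y)`, `P_N`-fixed, in `box ρ π P` (only
the linear clauses are used), and `‖y t‖ ≤ r` (`r > 0`). Then for `t ∈ [0, T]`, with
`S₃(t) = ‖Λ⁻² ⇑(y t)‖₃²`,

  `S₃(t) ≤ gronwallBound S₃(0) α₃ β₃ t`,  `α₃ = 2ν(2π)² + 2H(3)`,
  `β₃ = 27 c⁴ / (256 ε³)`,  `c = 2K₃ σ₂`,  `ε = 2ν(2π)²/r²`,  `K₃ = card d · 24 · 2π`,

`H(3)` the host constant of part VII at `σ = 3`. All constants are independent of the level `N`. -/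
theorem energy_three_le (hν : 0 < ν) (hUv : RapidDecay Uv) (hπ : ∀ j, ‖π j‖ ≤ 1)
    (hUreal : ∀ j p, π j (Uv (-p)) = conj (π j (Uv p)))
    (hUdiv : ∑ j, freqDeriv j (fun p => π j (Uv p)) = 0)
    (hPsa : ∀ k, IsSelfAdjoint (P k)) (hP : ∀ k, ‖P k‖ ≤ 1)
    (hσ₂ : ∑' l : d → ℤ, ENNReal.ofReal (sobolevWeight (-2) l ^ 2) < ∞)
    {N : ℕ} {y : ℝ → lp (fun _ : (d → ℤ) => V) 2} {T r : ℝ} (hr : 0 < r)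
    (hcont : ContinuousOn y (Icc 0 T))
    (hderiv : ∀ t ∈ Ico 0 T, HasDerivWithinAt y (cubeProj N (nsField ν Uv π P (y t))) (Ici t) t)
    (hproj : ∀ t ∈ Icc 0 T, cubeProj N (y t) = y t) (hW : ∀ t ∈ Icc 0 T, y t ∈ box ρ π P)
    (hbd : ∀ t ∈ Icc 0 T, ‖y t‖ ≤ r) :
    ∀ t ∈ Icc 0 T, (eNormSq 3 (wmul (-2) ⇑(y t))).toReal ≤
      gronwallBound ((eNormSq 3 (wmul (-2) ⇑(y 0))).toReal)
        (2 * ν * (2 * Real.pi) ^ 2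
          + 2 * ((3 * (2 : ℝ) ^ 3) * (2 * Real.pi) *
              (∑ j, (symbNorm (3 : ℝ) (scal (fun p => π j (Uv p)) : (d → ℤ) → (V →L[ℂ] V))).toReal)
            + (2 : ℝ) ^ ((3 : ℝ) / 2) * ((Fintype.card d : ℝ) * (2 * Real.pi)) *
              (∑' l, ENNReal.ofReal (sobolevWeight 4 l) * ‖Uv l‖ₑ).toReal))
        (27 * (2 * ((Fintype.card d : ℝ) * (3 * (2 : ℝ) ^ 3) * (2 * Real.pi)) *
              Real.sqrt (∑' l : d → ℤ, ENNReal.ofReal (sobolevWeight (-2) l ^ 2)).toReal) ^ 4 /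
          (256 * (2 * ν * (2 * Real.pi) ^ 2 / r ^ 2) ^ 3)) t := by
  -- constants
  set H : ℝ := (3 * (2 : ℝ) ^ 3) * (2 * Real.pi) *
      (∑ j, (symbNorm (3 : ℝ) (scal (fun p => π j (Uv p)) : (d → ℤ) → (V →L[ℂ] V))).toReal)
    + (2 : ℝ) ^ ((3 : ℝ) / 2) * ((Fintype.card d : ℝ) * (2 * Real.pi)) *
      (∑' l, ENNReal.ofReal (sobolevWeight 4 l) * ‖Uv l‖ₑ).toReal with hH
  set K : ℝ := (Fintype.card d : ℝ) * (3 * (2 : ℝ) ^ 3) * (2 * Real.pi) with hK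
  set s₂ : ℝ := Real.sqrt (∑' l : d → ℤ, ENNReal.ofReal (sobolevWeight (-2) l ^ 2)).toReal with hs₂
  set ε : ℝ := 2 * ν * (2 * Real.pi) ^ 2 / r ^ 2 with hε
  set c : ℝ := 2 * K * s₂ with hc
  have hK0 : 0 ≤ K := by positivity
  have hs₂0 : 0 ≤ s₂ := Real.sqrt_nonneg _
  have hc0 : 0 ≤ c := by positivity
  have hε0 : 0 < ε := by positivity
  have hνπ : 0 < 2 * ν * (2 * Real.pi) ^ 2 := by positivity
  -- the weight of order 3
  obtain ⟨D, hD⟩ := exists_levelWeight (d := d) (V := V) ((3 : ℕ) - 2 : ℝ) N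
  set f : ℝ → ℝ := fun τ => re ⟪D (y τ), y τ⟫_ℂ with hf
  -- `f = S₃` on the window
  have hfS : ∀ t ∈ Icc 0 T, f t = (eNormSq 3 (wmul (-2) ⇑(y t))).toReal := by
    intro t ht
    rw [hf]
    simp only
    rw [re_inner_levelWeight_self hD (hproj t ht), eNormSq_unscale]
    norm_num
  -- continuity and derivative of `f`
  have hfc : ContinuousOn f (Icc 0 T) := by
    have h1 : ContinuousOn (fun τ => ⟪D (y τ), y τ⟫_ℂ) (Icc 0 T) :=
      (D.continuous.comp_continuousOn hcont).inner hcont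
    exact RCLike.continuous_re.comp_continuousOn h1
  have hf' : ∀ t ∈ Ico 0 T, HasDerivWithinAt f
      (2 * re ⟪D (y t), cubeProj N (nsField ν Uv π P (y t))⟫_ℂ) (Ici t) t :=
    fun t ht => hasDerivWithinAt_levelEnergy hD (hderiv t ht)
  -- the differential inequality
  have hbound : ∀ t ∈ Ico 0 T, 2 * re ⟪D (y t), cubeProj N (nsField ν Uv π P (y t))⟫_ℂ ≤
      (2 * ν * (2 * Real.pi) ^ 2 + 2 * H) * f t + 27 * c ^ 4 / (256 * ε ^ 3) := by
    intro t ht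
    have htI : t ∈ Icc 0 T := Ico_subset_Icc_self ht
    have hx := hproj t htI
    have hxr : RapidDecay (⇑(y t)) := by rw [← hx]; exact rapidDecay_coe_cubeProj N (y t)
    have hle := two_re_inner_levelWeight_nsField_le (ν := ν) hUv hπ hUreal hUdiv hPsa hP
      (by norm_num : 1 ≤ 3) hD hx (hW t htI)
    simp only [Nat.cast_ofNat] at hle
    rw [show (3 : ℝ) + 1 = 4 by norm_num] at hle
    rw [hfS t htI]
    set û := wmul (-2) (⇑(y t)) with hû
    have hûr : RapidDecay û := rapidDecay_wmul hxr (-2)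
    set S₂ := (eNormSq 2 û).toReal with hS₂
    set S₃ := (eNormSq 3 û).toReal with hS₃
    set S₄ := (eNormSq 4 û).toReal with hS₄
    set A₁ := (∑' l, ENNReal.ofReal (sobolevWeight 1 l) * ‖û l‖ₑ).toReal with hA₁
    have hS₂0 : 0 ≤ S₂ := ENNReal.toReal_nonneg
    have hS₃0 : 0 ≤ S₃ := ENNReal.toReal_nonneg
    have hS₄0 : 0 ≤ S₄ := ENNReal.toReal_nonneg
    have hA₁0 : 0 ≤ A₁ := ENNReal.toReal_nonneg
    -- Cauchy–Schwarz twice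
    have hCS1 : A₁ ^ 2 ≤ s₂ ^ 2 * S₃ := by
      rw [hs₂, Real.sq_sqrt ENNReal.toReal_nonneg]
      exact weightOne_tsum_sq_le_toReal (eNormSq_lt_top_of_rapidDecay hûr _) hσ₂
    have hCS2 : S₃ ^ 2 ≤ S₂ * S₄ :=
      eNormSq_three_sq_le_toReal (eNormSq_lt_top_of_rapidDecay hûr _) (eNormSq_lt_top_of_rapidDecay hûr _)
    have hS₂r : S₂ ≤ r ^ 2 := by
      rw [hS₂, hû, ← norm_sq_eq_energy_two]
      exact pow_le_pow_left₀ (norm_nonneg _) (hbd t htI) 2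
    -- `A₁ ≤ s₂ √S₃`
    set Y := Real.sqrt S₃ with hY
    have hY0 : 0 ≤ Y := Real.sqrt_nonneg _
    have hYsq : Y ^ 2 = S₃ := Real.sq_sqrt hS₃0
    have hA₁Y : A₁ ≤ s₂ * Y := by
      have h : A₁ ^ 2 ≤ (s₂ * Y) ^ 2 := by rw [mul_pow, hYsq]; exact hCS1
      exact (pow_le_pow_iff_left₀ hA₁0 (by positivity) two_ne_zero).1 h
    -- absorption
    have hyoung := young_three_four hε0 c Y
    have hS4 : ε * Y ^ 4 ≤ 2 * ν * (2 * Real.pi) ^ 2 * S₄ := by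
      have h1 : Y ^ 4 = S₃ ^ 2 := by rw [show (4 : ℕ) = 2 * 2 by norm_num, pow_mul, hYsq]
      rw [h1, hε]
      have h2 : S₃ ^ 2 ≤ r ^ 2 * S₄ := hCS2.trans (mul_le_mul_of_nonneg_right hS₂r hS₄0)
      calc 2 * ν * (2 * Real.pi) ^ 2 / r ^ 2 * S₃ ^ 2
          ≤ 2 * ν * (2 * Real.pi) ^ 2 / r ^ 2 * (r ^ 2 * S₄) :=
            mul_le_mul_of_nonneg_left h2 (by positivity)
        _ = 2 * ν * (2 * Real.pi) ^ 2 * S₄ := by field_simp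
    have hKA : 2 * (K * A₁) * S₃ ≤ 2 * ν * (2 * Real.pi) ^ 2 * S₄ + 27 * c ^ 4 / (256 * ε ^ 3) := by
      have h1 : 2 * (K * A₁) * S₃ ≤ c * Y ^ 3 := by
        rw [hc, ← hYsq]
        have := mul_le_mul_of_nonneg_left hA₁Y hK0
        nlinarith [this, hY0, hK0, hs₂0]
      linarith
    have hHS : 0 ≤ H * S₃ ∨ True := Or.inr trivial
    nlinarith [hle, hKA, hS₃0, hK0, hA₁0]
  -- Gronwall
  intro t ht
  have hG := le_gronwallBound_of_hasDerivWithinAt hfc hf' hbound t ht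
  rw [sub_zero, hfS 0 ⟨le_rfl, ht.1.trans ht.2⟩, hfS t ht] at hG
  simpa only [hH, hc, hK, hs₂, hε] using hG

end OrderThree

/-! ## §4 Every order, once order three is bounded -/

section HigherOrder

variable {ν : ℝ} {Uv : (d → ℤ) → V} {π : d → (V →L[ℂ] ℂ)} {P : (d → ℤ) → (V →L[ℂ] V)}
  {ρ : (d → ℤ) → ℝ}

/-- **Every order `σ ≥ 1` (`energy_le_of_energy_three_le`).** Same host and trajectory as
`energy_three_le` (`ν ≥ 0` suffices here), plus a bound `S₃(t) ≤ R₃` on the window. Then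

  `S_σ(t) ≤ S_σ(0) · exp(α t)`,  `α = 2ν(2π)² + 2H(σ) + 2K_σ σ₂ √R₃`,

because `A₁(û) ≤ σ₂ √S₃ ≤ σ₂ √R₃` makes part VIII's inequality LINEAR and the dissipation term
`−2ν(2π)² S_{σ+1}` is simply dropped. -/
theorem energy_le_of_energy_three_le (hν : 0 ≤ ν) (hUv : RapidDecay Uv) (hπ : ∀ j, ‖π j‖ ≤ 1)
    (hUreal : ∀ j p, π j (Uv (-p)) = conj (π j (Uv p)))
    (hUdiv : ∑ j, freqDeriv j (fun p => π j (Uv p)) = 0)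
    (hPsa : ∀ k, IsSelfAdjoint (P k)) (hP : ∀ k, ‖P k‖ ≤ 1)
    (hσ₂ : ∑' l : d → ℤ, ENNReal.ofReal (sobolevWeight (-2) l ^ 2) < ∞)
    {σ : ℕ} (hσ : 1 ≤ σ) {N : ℕ} {y : ℝ → lp (fun _ : (d → ℤ) => V) 2} {T R₃ : ℝ} (hR₃ : 0 ≤ R₃)
    (hcont : ContinuousOn y (Icc 0 T))
    (hderiv : ∀ t ∈ Ico 0 T, HasDerivWithinAt y (cubeProj N (nsField ν Uv π P (y t))) (Ici t) t)
    (hproj : ∀ t ∈ Icc 0 T, cubeProj N (y t) = y t) (hW : ∀ t ∈ Icc 0 T, y t ∈ box ρ π P)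
    (h3 : ∀ t ∈ Icc 0 T, (eNormSq 3 (wmul (-2) ⇑(y t))).toReal ≤ R₃) :
    ∀ t ∈ Icc 0 T, (eNormSq (σ : ℝ) (wmul (-2) ⇑(y t))).toReal ≤
      (eNormSq (σ : ℝ) (wmul (-2) ⇑(y 0))).toReal *
        Real.exp ((2 * ν * (2 * Real.pi) ^ 2
          + 2 * ((σ * (2 : ℝ) ^ σ) * (2 * Real.pi) *
              (∑ j, (symbNorm (σ : ℝ) (scal (fun p => π j (Uv p)) : (d → ℤ) → (V →L[ℂ] V))).toReal)
            + (2 : ℝ) ^ ((σ : ℝ) / 2) * ((Fintype.card d : ℝ) * (2 * Real.pi)) *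
              (∑' l, ENNReal.ofReal (sobolevWeight ((σ : ℝ) + 1) l) * ‖Uv l‖ₑ).toReal)
          + 2 * ((Fintype.card d : ℝ) * (σ * (2 : ℝ) ^ σ) * (2 * Real.pi)) *
              Real.sqrt (∑' l : d → ℤ, ENNReal.ofReal (sobolevWeight (-2) l ^ 2)).toReal *
              Real.sqrt R₃) * t) := by
  set H : ℝ := (σ * (2 : ℝ) ^ σ) * (2 * Real.pi) *
      (∑ j, (symbNorm (σ : ℝ) (scal (fun p => π j (Uv p)) : (d → ℤ) → (V →L[ℂ] V))).toReal)
    + (2 : ℝ) ^ ((σ : ℝ) / 2) * ((Fintype.card d : ℝ) * (2 * Real.pi)) *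
      (∑' l, ENNReal.ofReal (sobolevWeight ((σ : ℝ) + 1) l) * ‖Uv l‖ₑ).toReal with hH
  set K : ℝ := (Fintype.card d : ℝ) * (σ * (2 : ℝ) ^ σ) * (2 * Real.pi) with hK
  set s₂ : ℝ := Real.sqrt (∑' l : d → ℤ, ENNReal.ofReal (sobolevWeight (-2) l ^ 2)).toReal with hs₂
  have hK0 : 0 ≤ K := by positivity
  have hs₂0 : 0 ≤ s₂ := Real.sqrt_nonneg _
  -- the weight of order σ
  obtain ⟨D, hD⟩ := exists_levelWeight (d := d) (V := V) ((σ : ℝ) - 2) N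
  set f : ℝ → ℝ := fun τ => re ⟪D (y τ), y τ⟫_ℂ with hf
  have hfS : ∀ t ∈ Icc 0 T, f t = (eNormSq (σ : ℝ) (wmul (-2) ⇑(y t))).toReal := by
    intro t ht
    rw [hf]
    simp only
    rw [re_inner_levelWeight_self hD (hproj t ht), eNormSq_unscale]
  have hfc : ContinuousOn f (Icc 0 T) := by
    have h1 : ContinuousOn (fun τ => ⟪D (y τ), y τ⟫_ℂ) (Icc 0 T) :=
      (D.continuous.comp_continuousOn hcont).inner hcont
    exact RCLike.continuous_re.comp_continuousOn h1
  have hf' : ∀ t ∈ Ico 0 T, HasDerivWithinAt f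
      (2 * re ⟪D (y t), cubeProj N (nsField ν Uv π P (y t))⟫_ℂ) (Ici t) t :=
    fun t ht => hasDerivWithinAt_levelEnergy hD (hderiv t ht)
  have hbound : ∀ t ∈ Ico 0 T, 2 * re ⟪D (y t), cubeProj N (nsField ν Uv π P (y t))⟫_ℂ ≤
      (2 * ν * (2 * Real.pi) ^ 2 + 2 * H + 2 * K * s₂ * Real.sqrt R₃) * f t + 0 := by
    intro t ht
    have htI : t ∈ Icc 0 T := Ico_subset_Icc_self ht
    have hx := hproj t htI
    have hxr : RapidDecay (⇑(y t)) := by rw [← hx]; exact rapidDecay_coe_cubeProj N (y t)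
    have hle := two_re_inner_levelWeight_nsField_le (ν := ν) hUv hπ hUreal hUdiv hPsa hP hσ hD hx (hW t htI)
    rw [hfS t htI]
    set û := wmul (-2) (⇑(y t)) with hû
    have hûr : RapidDecay û := rapidDecay_wmul hxr (-2)
    set Sσ := (eNormSq (σ : ℝ) û).toReal with hSσ
    set Sσ1 := (eNormSq ((σ : ℝ) + 1) û).toReal with hSσ1
    set S₃ := (eNormSq 3 û).toReal with hS₃
    set A₁ := (∑' l, ENNReal.ofReal (sobolevWeight 1 l) * ‖û l‖ₑ).toReal with hA₁
    have hSσ0 : 0 ≤ Sσ := ENNReal.toReal_nonneg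
    have hSσ10 : 0 ≤ Sσ1 := ENNReal.toReal_nonneg
    have hS₃0 : 0 ≤ S₃ := ENNReal.toReal_nonneg
    have hA₁0 : 0 ≤ A₁ := ENNReal.toReal_nonneg
    have hCS1 : A₁ ^ 2 ≤ s₂ ^ 2 * S₃ := by
      rw [hs₂, Real.sq_sqrt ENNReal.toReal_nonneg]
      exact weightOne_tsum_sq_le_toReal (eNormSq_lt_top_of_rapidDecay hûr _) hσ₂
    have hA₁R : A₁ ≤ s₂ * Real.sqrt R₃ := by
      have h : A₁ ^ 2 ≤ (s₂ * Real.sqrt R₃) ^ 2 := by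
        rw [mul_pow, Real.sq_sqrt hR₃]
        exact hCS1.trans (mul_le_mul_of_nonneg_left (h3 t htI) (sq_nonneg _))
      exact (pow_le_pow_iff_left₀ hA₁0 (by positivity) two_ne_zero).1 h
    have hKA : K * A₁ * Sσ ≤ K * s₂ * Real.sqrt R₃ * Sσ := by
      have := mul_le_mul_of_nonneg_left hA₁R hK0
      nlinarith [this, hSσ0]
    rw [← hH, ← hK] at hle
    have hνS : 0 ≤ 2 * ν * (2 * Real.pi) ^ 2 * Sσ1 := by positivity
    nlinarith [hle, hKA, hSσ0, hνS]
  intro t ht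
  have hG := le_gronwallBound_of_hasDerivWithinAt hfc hf' hbound t ht
  rw [sub_zero, gronwallBound_ε0, hfS 0 ⟨le_rfl, ht.1.trans ht.2⟩, hfS t ht] at hG
  simpa only [hH, hK, hs₂] using hG

end HigherOrder

end Summit.NavierStokesRegularity.FluidComputer.TransportGalerkinResidence

end
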